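import Mathlib
import Summits.Ventures.LatticeQCDFlow.Scoring.CalibrationTruths
import Summits.Ventures.LatticeQCDFlow.Scoring.LagProductCovariance
import Summits.Ventures.LatticeQCDFlow.Scoring.FejerPairSums
import Summits.Ventures.LatticeQCDFlow.Scoring.BartlettKernel
import Summits.Ventures.LatticeQCDFlow.Scoring.MadrasSokalErrorFormula
import HarnessLib

/-!
# The Madras–Sokal error bar for the RATIO estimator `½ + Σ_{t≤W} Γ̂(t)/Γ̂(0)`: its linearisation is unbiased for `τ_W`, `N · Var → R(W) = V(W) − 4 a_W b_W + 2 K(0) a_W²`, the correction is `O(1)` in `W` (same asymptote `4 W τ_int²`) and NON-POSITIVE in the limit for `0 ≤ ρ ≤ 1`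

HONEST FRAMING: exact (Metropolis-corrected) sampling algorithms for lattice gauge theory;
figures of merit are autocorrelation/cost numbers at stated couplings and volumes; no
continuum-physics claim.

Venture `LatticeQCDFlow` (cell pub-lqcd), sub-topic `Scoring`; FANOUT row 16 (`su2-base`), GEN-6.
NEW WORK of the cell over this packet (`LagProductCovariance`, `FejerPairSums`, `BartlettKernel`,
`MadrasSokalErrorFormula`) and `CalibrationTruths.tauInt/tauIntWindow`.  Nothing is cited as a
fact.  Printed counterparts, NAMED ONLY: Madras–Sokal 1988 App. C; Wolff 2004 §3.3; Priestley 1981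
§5.3.4 (Bartlett's formula for autocorrelations, the `−2ρ(s)…` terms); the delta method (Cramér).

Fifth file of the ERROR-OF-THE-ERROR packet.  The scorers' estimator normalises by the empirical
variance, `τ̂_W = ½ + Σ_{t=1}^{W} Γ̂_N(t)/Γ̂_N(0)`.  Its first-order expansion at the truth
`(Γ̂(t), Γ̂(0)) = (σ²ρ(t), σ²)` is the LINEARISED ratio statistic
`τ̂_W^lin = τ_W + σ⁻² Σ_{t=1}^{W} (Γ̂(t) − ρ(t) Γ̂(0))` (`tauHatRatioLin`).  With `K = acfConv ρ̄`,
`B = bartlettKernel ρ̄`, `V(W) = tauHatAVar ρ W`, `a_W = Σ_{t=1}^{W} ρ(t) = τ_W − ½`,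
`b_W = Σ_{t=1}^{W} K(t)`, `τ = tauInt ρ`, `τ₁ = τ − ½`:

* `integral_tauHatRatioLin` — `E[τ̂_W^lin] = τ_W` (`CalibrationTruths.tauIntWindow`) for a
  stationary Wick family: unbiased for the WINDOWED truth (the truncation bias `τ − τ_W` is the
  other, deterministic error, `WolffWindow` / `MadrasSokalWindow`);
* `ratioKernel ρ s t = B(s+1,t+1) − ρ(t+1) B(s+1,0) − ρ(s+1) B(0,t+1) + ρ(s+1)ρ(t+1) B(0,0)`,
  `tauHatRatioAVar ρ W = R(W) = Σ_{s,t<W} ratioKernel ρ s t`;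
  **`IsWickFamily.tendsto_variance_tauHatRatioLin`** — `N · Var[τ̂_W^lin] → R(W)` (`N → ∞`);
* **`tauHatRatioAVar_eq`** — `R(W) = V(W) − 4 a_W b_W + 2 K(0) a_W²` (`B(s+1,0) = 2K(s+1)`,
  `B(0,0) = 2K(0)`);
* **`tendsto_tauHatRatioAVar_sub`** — `R(W) − V(W) → L = −4 τ₁ S₁ + 2 K(0) τ₁²` with
  `S₁ = Σ_{t≥1} K(t)`, `K(0) + 2 S₁ = 4τ²` (`acfConv_zero_add_two_mul_tsum`): the ratio correction is
  `O(1)` in `W`; hence **`tendsto_tauHatRatioAVar_div`** — `R(W)/W → 4 τ_int²`: the printed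
  `(4W+2)τ²` is the large-window asymptote for the ratio estimator too
  (`tendsto_tauHatRatioAVar_div_printed`);
* **`ratioLimit_le`** — for `0 ≤ ρ ≤ 1`: `K(0) ≤ 2τ` and `L ≤ −4 τ τ₁² ≤ 0`; so
  **`eventually_tauHatRatioAVar_lt_printed`** — for all large `W`, `R(W) < (4W+2) τ²`: in the
  Gaussian model with non-negative autocorrelations the printed bar eventually over-covers the
  ratio estimator as well (numerically, on set C-1 at the `c = 6` window, `R(W)/((4W+2)τ²) ≈ 0.63`,
  i.e. the bar is ≈ 1.26× the model standard deviation — a number from the cell's check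
  `HOME/su2-base/lean-gen6/ms_check2.py`, Monte Carlo `ms_mc2.py`; NOT a theorem here).

NOT CLAIMED: that `Var[τ̂_W] − Var[τ̂_W^lin] → 0` at rate `o(1/N)` (the delta-method remainder —
needs moment bounds on `1/Γ̂(0)`, not attempted); a CLT; anything at finite `N` about the ratio
itself; mean subtraction; the automatic-window coupling.
-/

noncomputable section

open MeasureTheory ProbabilityTheory Finset Filter Topology

namespace Summit.Ventures.LatticeQCDFlow.Scoring

variable {Ω : Type*} {mΩ : MeasurableSpace Ω} {μ : Measure Ω}

/-! ## The linearised ratio statistic and its kernel -/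

/-- The LINEARISED ratio estimator `τ̂_W^lin = τ_W + σ⁻² Σ_{t=1}^{W} (Γ̂_N(t) − ρ(t) Γ̂_N(0))`: the
first-order expansion of `½ + Σ_{t≤W} Γ̂(t)/Γ̂(0)` at `(Γ̂(t), Γ̂(0)) = (σ²ρ(t), σ²)`. [ours] -/
def tauHatRatioLin (X : ℕ → Ω → ℝ) (σ2 : ℝ) (ρ : ℕ → ℝ) (N W : ℕ) : Ω → ℝ :=
  fun ω => tauIntWindow ρ W
    + (∑ t ∈ range W, (acovHat X N (t + 1) ω - ρ (t + 1) * acovHat X N 0 ω)) / σ2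

/-- The RATIO KERNEL: `B(s+1,t+1) − ρ(t+1) B(s+1,0) − ρ(s+1) B(0,t+1) + ρ(s+1)ρ(t+1) B(0,0)`,
`B = bartlettKernel ρ̄` (Bartlett's formula for autoCORRELATIONS, before summation). [ours] -/
def ratioKernel (ρ : ℕ → ℝ) (s t : ℕ) : ℝ :=
  bartlettKernel (evenExt ρ) (s + 1) (t + 1) - ρ (t + 1) * bartlettKernel (evenExt ρ) (s + 1) 0
    - ρ (s + 1) * bartlettKernel (evenExt ρ) 0 (t + 1)
    + ρ (s + 1) * ρ (t + 1) * bartlettKernel (evenExt ρ) 0 0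

/-- `R(W) = Σ_{s<W} Σ_{t<W} ratioKernel ρ s t`: the `N → ∞` limit of `N · Var[τ̂_W^lin]`. [ours] -/
def tauHatRatioAVar (ρ : ℕ → ℝ) (W : ℕ) : ℝ :=
  ∑ s ∈ range W, ∑ t ∈ range W, ratioKernel ρ s t

namespace IsWickFamily

variable [IsProbabilityMeasure μ] {X : ℕ → Ω → ℝ} {C : ℕ → ℕ → ℝ} {ρ : ℕ → ℝ} {σ2 : ℝ}

/-- **`E[τ̂_W^lin] = τ_W`**: the linearised ratio statistic is unbiased for the WINDOWED integrated
autocorrelation time (`N ≥ 1`, stationary Wick family with `C i j = σ² ρ̄(j−i)`, `ρ 0 = 1`). -/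
theorem integral_tauHatRatioLin (h : IsWickFamily X C μ)
    (hC : ∀ i j, C i j = σ2 * evenExt ρ ((j : ℤ) - i)) (h0 : ρ 0 = 1) {N : ℕ} (hN : N ≠ 0) (W : ℕ) :
    ∫ ω, tauHatRatioLin X σ2 ρ N W ω ∂μ = tauIntWindow ρ W := by
  set c : ℤ → ℝ := fun m => σ2 * evenExt ρ m with hc_def
  have hC' : ∀ i j, C i j = c ((j : ℤ) - i) := fun i j => by rw [hC]
  have hmean : ∀ t : ℕ, ∫ ω, acovHat X N t ω ∂μ = c t := fun t =>
    h.integral_acovHat_of_stationary hC' hN t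
  have hI : ∀ t, Integrable (acovHat X N t) μ := fun t => (h.memLp_acovHat N t).integrable one_le_two
  have hD : ∀ t ∈ range W, Integrable
      (fun ω => acovHat X N (t + 1) ω - ρ (t + 1) * acovHat X N 0 ω) μ :=
    fun t _ => (hI (t + 1)).sub ((hI 0).const_mul _)
  unfold tauHatRatioLin
  rw [integral_add (integrable_const _) ((integrable_finsetSum _ hD).div_const _), integral_const,
    integral_div, integral_finsetSum _ hD]
  simp only [probReal_univ, smul_eq_mul, one_mul]
  have hz : ∀ t ∈ range W,
      ∫ ω, (acovHat X N (t + 1) ω - ρ (t + 1) * acovHat X N 0 ω) ∂μ = 0 := by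
    intro t _
    rw [integral_sub (hI _) ((hI 0).const_mul _), integral_const_mul, hmean, hmean]
    simp only [hc_def, Nat.cast_zero, evenExt_zero, h0, mul_one]
    rw [evenExt_natCast]
    ring
  rw [sum_congr rfl hz, sum_const_zero, zero_div, add_zero]

/-- **`N · Var[τ̂_W^lin] → R(W)`** for a stationary Wick family with covariance `σ² ρ̄` (`σ² ≠ 0`,
`Σ|ρ| < ∞`), at every fixed window `W`. -/
theorem tendsto_variance_tauHatRatioLin (h : IsWickFamily X C μ)
    (hC : ∀ i j, C i j = σ2 * evenExt ρ ((j : ℤ) - i)) (hσ : σ2 ≠ 0) (hρ : Summable ρ) (W : ℕ) :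
    Tendsto (fun N : ℕ => (N : ℝ) * Var[tauHatRatioLin X σ2 ρ N W; μ]) atTop
      (𝓝 (tauHatRatioAVar ρ W)) := by
  set c : ℤ → ℝ := fun m => σ2 * evenExt ρ m with hc_def
  have hc : Summable c := (summable_evenExt hρ).mul_left σ2
  have hC' : ∀ i j, C i j = c ((j : ℤ) - i) := fun i j => by rw [hC]
  -- the deviations `D_t = Γ̂(t+1) − ρ(t+1) Γ̂(0)`
  set D : ℕ → ℕ → Ω → ℝ := fun N t ω => acovHat X N (t + 1) ω - ρ (t + 1) * acovHat X N 0 ω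
    with hD_def
  have hDm : ∀ N t, MemLp (D N t) 2 μ := fun N t =>
    (h.memLp_acovHat N (t + 1)).sub ((h.memLp_acovHat N 0).const_mul _)
  -- covariance of two deviations
  have hcovD : ∀ N s t, cov[D N s, D N t; μ]
      = cov[acovHat X N (s + 1), acovHat X N (t + 1); μ]
        - ρ (t + 1) * cov[acovHat X N (s + 1), acovHat X N 0; μ]
        - ρ (s + 1) * cov[acovHat X N 0, acovHat X N (t + 1); μ]
        + ρ (s + 1) * ρ (t + 1) * cov[acovHat X N 0, acovHat X N 0; μ] := by
    intro N s t
    simp only [hD_def]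
    rw [covariance_fun_sub_fun_sub (h.memLp_acovHat N (s + 1)) ((h.memLp_acovHat N 0).const_mul _)
      (h.memLp_acovHat N (t + 1)) ((h.memLp_acovHat N 0).const_mul _),
      covariance_const_mul_right, covariance_const_mul_left, covariance_const_mul_left,
      covariance_const_mul_right]
    ring
  -- the variance as a double sum
  have hvar : ∀ N : ℕ, Var[tauHatRatioLin X σ2 ρ N W; μ]
      = (∑ s ∈ range W, ∑ t ∈ range W, cov[D N s, D N t; μ]) / σ2 / σ2 := by
    intro N
    have hS : MemLp (fun ω => ∑ t ∈ range W, D N t ω) 2 μ := memLp_finsetSum _ fun t _ => hDm N t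
    have hI : Integrable (fun ω => (∑ t ∈ range W, D N t ω) / σ2) μ :=
      (hS.integrable one_le_two).div_const _
    rw [← covariance_self (by
      exact (hI.aestronglyMeasurable.aemeasurable.const_add (tauIntWindow ρ W)))]
    unfold tauHatRatioLin
    rw [covariance_const_add_left hI, covariance_const_add_right hI, covariance_fun_div_left,
      covariance_fun_div_right, covariance_fun_sum_fun_sum' (fun s _ => hDm N s) (fun t _ => hDm N t)]
  -- termwise limits
  have hB : ∀ s t : ℕ, Tendsto (fun N : ℕ => (N : ℝ) * cov[acovHat X N s, acovHat X N t; μ]) atTop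
      (𝓝 (bartlettKernel c s t)) := fun s t => h.tendsto_covariance_acovHat' hC' hc s t
  have hlimD : ∀ s t : ℕ, Tendsto (fun N : ℕ => (N : ℝ) * cov[D N s, D N t; μ]) atTop
      (𝓝 (bartlettKernel c (s + 1) (t + 1) - ρ (t + 1) * bartlettKernel c (s + 1) 0
        - ρ (s + 1) * bartlettKernel c 0 (t + 1)
        + ρ (s + 1) * ρ (t + 1) * bartlettKernel c 0 0)) := by
    intro s t
    have := (((hB (s + 1) (t + 1)).sub ((hB (s + 1) 0).const_mul (ρ (t + 1)))).sub
      ((hB 0 (t + 1)).const_mul (ρ (s + 1)))).add ((hB 0 0).const_mul (ρ (s + 1) * ρ (t + 1)))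
    refine this.congr fun N => ?_
    rw [hcovD]
    ring
  have hlim : Tendsto (fun N : ℕ => (∑ s ∈ range W, ∑ t ∈ range W,
      (N : ℝ) * cov[D N s, D N t; μ]) / σ2 / σ2) atTop
      (𝓝 ((∑ s ∈ range W, ∑ t ∈ range W,
        (bartlettKernel c (s + 1) (t + 1) - ρ (t + 1) * bartlettKernel c (s + 1) 0
          - ρ (s + 1) * bartlettKernel c 0 (t + 1)
          + ρ (s + 1) * ρ (t + 1) * bartlettKernel c 0 0)) / σ2 / σ2)) :=
    ((tendsto_finsetSum _ fun s _ => tendsto_finsetSum _ fun t _ => hlimD s t).div_const _).div_const _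
  have hval : (∑ s ∈ range W, ∑ t ∈ range W,
        (bartlettKernel c (s + 1) (t + 1) - ρ (t + 1) * bartlettKernel c (s + 1) 0
          - ρ (s + 1) * bartlettKernel c 0 (t + 1)
          + ρ (s + 1) * ρ (t + 1) * bartlettKernel c 0 0)) / σ2 / σ2
      = tauHatRatioAVar ρ W := by
    have hk : ∀ s t, bartlettKernel c (s + 1) (t + 1) - ρ (t + 1) * bartlettKernel c (s + 1) 0
          - ρ (s + 1) * bartlettKernel c 0 (t + 1)
          + ρ (s + 1) * ρ (t + 1) * bartlettKernel c 0 0 = σ2 ^ 2 * ratioKernel ρ s t := by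
      intro s t
      simp only [hc_def, bartlettKernel_const_mul, ratioKernel]
      ring
    simp only [hk, tauHatRatioAVar, ← mul_sum]
    field_simp
  rw [← hval]
  refine hlim.congr fun N => ?_
  rw [hvar N, ← mul_div_assoc, ← mul_div_assoc, mul_sum]
  simp_rw [mul_sum]

end IsWickFamily

/-! ## Closed form of the correction: `R(W) = V(W) − 4 a_W b_W + 2 K(0) a_W²` -/

/-- `B(s+1, 0) = 2 K(s+1)`. -/
theorem bartlettKernel_succ_zero (c : ℤ → ℝ) (s : ℕ) :
    bartlettKernel c (s + 1) 0 = 2 * acfConv c ((s + 1 : ℕ) : ℤ) := by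
  rw [bartlettKernel_def, Nat.cast_zero, zero_sub, zero_add, acfConv_neg]
  ring

/-- `B(0, t+1) = 2 K(t+1)`. -/
theorem bartlettKernel_zero_succ (c : ℤ → ℝ) (t : ℕ) :
    bartlettKernel c 0 (t + 1) = 2 * acfConv c ((t + 1 : ℕ) : ℤ) := by
  rw [bartlettKernel_comm, bartlettKernel_succ_zero]

/-- `B(0, 0) = 2 K(0)`. -/
theorem bartlettKernel_zero_zero (c : ℤ → ℝ) : bartlettKernel c 0 0 = 2 * acfConv c 0 := by
  rw [bartlettKernel_def, Nat.cast_zero, sub_zero, add_zero]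
  ring

/-- `a_W = Σ_{t<W} ρ(t+1) = τ_W − ½`. -/
theorem sum_range_succ_eq_tauIntWindow (ρ : ℕ → ℝ) (W : ℕ) :
    ∑ t ∈ range W, ρ (t + 1) = tauIntWindow ρ W - 1 / 2 := by
  rw [tauIntWindow]
  ring

/-- **`R(W) = V(W) − 4 a_W b_W + 2 K(0) a_W²`** with `a_W = Σ_{t<W} ρ(t+1)`, `b_W = Σ_{t<W} K(t+1)`. -/
theorem tauHatRatioAVar_eq (ρ : ℕ → ℝ) (W : ℕ) :
    tauHatRatioAVar ρ W = tauHatAVar ρ W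
      - 4 * (∑ t ∈ range W, ρ (t + 1)) * (∑ t ∈ range W, acfConv (evenExt ρ) ((t + 1 : ℕ) : ℤ))
      + 2 * acfConv (evenExt ρ) 0 * (∑ t ∈ range W, ρ (t + 1)) ^ 2 := by
  simp only [tauHatRatioAVar, ratioKernel, tauHatAVar, bartlettKernel_succ_zero,
    bartlettKernel_zero_succ, bartlettKernel_zero_zero, sum_add_distrib, sum_sub_distrib]
  have h1 : ∑ s ∈ range W, ∑ t ∈ range W, ρ (t + 1) * (2 * acfConv (evenExt ρ) ((s + 1 : ℕ) : ℤ))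
      = 2 * (∑ t ∈ range W, ρ (t + 1)) * ∑ s ∈ range W, acfConv (evenExt ρ) ((s + 1 : ℕ) : ℤ) := by
    rw [mul_assoc, sum_mul_sum, mul_sum, sum_comm]
    refine sum_congr rfl fun s _ => ?_
    rw [mul_sum]
    refine sum_congr rfl fun t _ => by ring
  have h2 : ∑ s ∈ range W, ∑ t ∈ range W, ρ (s + 1) * (2 * acfConv (evenExt ρ) ((t + 1 : ℕ) : ℤ))
      = 2 * (∑ t ∈ range W, ρ (t + 1)) * ∑ s ∈ range W, acfConv (evenExt ρ) ((s + 1 : ℕ) : ℤ) := by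
    rw [mul_assoc, sum_mul_sum, mul_sum]
    refine sum_congr rfl fun s _ => ?_
    rw [mul_sum]
    refine sum_congr rfl fun t _ => by ring
  have h3 : ∑ s ∈ range W, ∑ t ∈ range W, ρ (s + 1) * ρ (t + 1) * (2 * acfConv (evenExt ρ) 0)
      = 2 * acfConv (evenExt ρ) 0 * (∑ t ∈ range W, ρ (t + 1)) ^ 2 := by
    rw [sq, sum_mul_sum, mul_sum]
    refine sum_congr rfl fun s _ => ?_
    rw [mul_sum]
    refine sum_congr rfl fun t _ => by ring
  rw [h1, h2, h3]
  ring

/-! ## Limits: the correction is `O(1)`, the asymptote is unchanged -/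

/-- `K(0) + 2 Σ_{t≥1} K(t) = Σ_ℤ K = 4 τ_int²`. -/
theorem acfConv_zero_add_two_mul_tsum {ρ : ℕ → ℝ} (hρ : Summable ρ) (h0 : ρ 0 = 1) :
    acfConv (evenExt ρ) 0 + 2 * ∑' t : ℕ, acfConv (evenExt ρ) ((t + 1 : ℕ) : ℤ)
      = 4 * tauInt ρ ^ 2 := by
  have hK : Summable (acfConv (evenExt ρ)) := summable_acfConv (summable_evenExt hρ)
  rw [← tsum_acfConv_evenExt hρ h0, tsum_int_eq_zero_add_tsum_nat hK]
  have : ∀ t : ℕ, acfConv (evenExt ρ) ((t : ℤ) + 1) + acfConv (evenExt ρ) (-((t : ℤ) + 1))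
      = 2 * acfConv (evenExt ρ) ((t + 1 : ℕ) : ℤ) := by
    intro t
    rw [acfConv_neg]
    push_cast
    ring
  simp_rw [this]
  rw [tsum_mul_left]

/-- `a_W → τ₁ = τ_int − ½`. -/
theorem tendsto_sum_range_succ {ρ : ℕ → ℝ} (hρ : Summable ρ) :
    Tendsto (fun W : ℕ => ∑ t ∈ range W, ρ (t + 1)) atTop (𝓝 (tauInt ρ - 1 / 2)) := by
  have := ((summable_nat_add_iff 1).mpr hρ).hasSum.tendsto_sum_nat
  rw [tauInt]
  convert this using 2
  ring

/-- `b_W → S₁ = Σ_{t≥1} K(t)`. -/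
theorem tendsto_sum_range_acfConv_succ {ρ : ℕ → ℝ} (hρ : Summable ρ) :
    Tendsto (fun W : ℕ => ∑ t ∈ range W, acfConv (evenExt ρ) ((t + 1 : ℕ) : ℤ)) atTop
      (𝓝 (∑' t : ℕ, acfConv (evenExt ρ) ((t + 1 : ℕ) : ℤ))) := by
  have hK : Summable (acfConv (evenExt ρ)) := summable_acfConv (summable_evenExt hρ)
  have hK1 : Summable fun t : ℕ => acfConv (evenExt ρ) ((t + 1 : ℕ) : ℤ) :=
    (summable_nat_add_iff 1).mpr (summable_nat_of_summable_int hK)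
  exact hK1.hasSum.tendsto_sum_nat

/-- The limit of the ratio correction: `L = −4 τ₁ S₁ + 2 K(0) τ₁²`. [ours] -/
def ratioLimit (ρ : ℕ → ℝ) : ℝ :=
  -4 * (tauInt ρ - 1 / 2) * (∑' t : ℕ, acfConv (evenExt ρ) ((t + 1 : ℕ) : ℤ))
    + 2 * acfConv (evenExt ρ) 0 * (tauInt ρ - 1 / 2) ^ 2

/-- **The ratio correction is `O(1)` in the window**: `R(W) − V(W) → L`. -/
theorem tendsto_tauHatRatioAVar_sub {ρ : ℕ → ℝ} (hρ : Summable ρ) :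
    Tendsto (fun W : ℕ => tauHatRatioAVar ρ W - tauHatAVar ρ W) atTop (𝓝 (ratioLimit ρ)) := by
  have ha := tendsto_sum_range_succ hρ
  have hb := tendsto_sum_range_acfConv_succ hρ
  have := ((ha.const_mul (-4)).mul hb).add ((ha.pow 2).const_mul (2 * acfConv (evenExt ρ) 0))
  rw [ratioLimit]
  refine (this.congr fun W => ?_)
  rw [tauHatRatioAVar_eq]
  ring

/-- **The Madras–Sokal asymptote for the ratio estimator**: `R(W)/W → 4 τ_int²`. -/
theorem tendsto_tauHatRatioAVar_div {ρ : ℕ → ℝ} (hρ : Summable ρ) (h0 : ρ 0 = 1) :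
    Tendsto (fun W : ℕ => tauHatRatioAVar ρ W / W) atTop (𝓝 (4 * tauInt ρ ^ 2)) := by
  have hV := tendsto_tauHatAVar_div hρ h0
  have hcorr : Tendsto (fun W : ℕ => (tauHatRatioAVar ρ W - tauHatAVar ρ W) / W) atTop (𝓝 0) :=
    (tendsto_tauHatRatioAVar_sub hρ).div_atTop tendsto_natCast_atTop_atTop
  have := hV.add hcorr
  rw [add_zero] at this
  refine this.congr fun W => ?_
  ring

/-- Equivalently `R(W) / ((4W+2) τ²) → 1` (`τ_int ≠ 0`). -/
theorem tendsto_tauHatRatioAVar_div_printed {ρ : ℕ → ℝ} (hρ : Summable ρ) (h0 : ρ 0 = 1)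
    (hτ : tauInt ρ ≠ 0) :
    Tendsto (fun W : ℕ => tauHatRatioAVar ρ W / ((4 * W + 2) * tauInt ρ ^ 2)) atTop (𝓝 1) := by
  have hA := tendsto_tauHatRatioAVar_div hρ h0
  have hB : Tendsto (fun W : ℕ => (4 * (W : ℝ) + 2) * tauInt ρ ^ 2 / W) atTop
      (𝓝 (4 * tauInt ρ ^ 2)) := by
    have h2 : Tendsto (fun W : ℕ => (2 : ℝ) * tauInt ρ ^ 2 / W) atTop (𝓝 0) :=
      tendsto_const_div_atTop_nhds_zero_nat _
    have := (tendsto_const_nhds (x := 4 * tauInt ρ ^ 2)).add h2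
    rw [add_zero] at this
    refine this.congr' ?_
    filter_upwards [eventually_ne_atTop 0] with W hW
    have : (W : ℝ) ≠ 0 := Nat.cast_ne_zero.mpr hW
    field_simp
  have hne : (4 : ℝ) * tauInt ρ ^ 2 ≠ 0 := by positivity
  have := hA.div hB hne
  rw [div_self hne] at this
  refine this.congr' ?_
  filter_upwards [eventually_ne_atTop 0] with W hW
  have hW' : (W : ℝ) ≠ 0 := Nat.cast_ne_zero.mpr hW
  simp only [Pi.div_apply]
  rw [div_div_div_cancel_right₀ hW']

/-! ## Sign of the correction for `0 ≤ ρ ≤ 1` -/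

/-- `K(0) = Σ_ℤ ρ̄² ≤ Σ_ℤ ρ̄ = 2 τ_int` when `0 ≤ ρ ≤ 1`. -/
theorem acfConv_zero_le_two_mul_tauInt {ρ : ℕ → ℝ} (hρ : Summable ρ) (h0 : ρ 0 = 1)
    (hnn : ∀ t, 0 ≤ ρ t) (hle : ∀ t, ρ t ≤ 1) :
    acfConv (evenExt ρ) 0 ≤ 2 * tauInt ρ := by
  rw [acfConv_zero, ← tsum_evenExt hρ h0]
  refine Summable.tsum_le_tsum (fun m => ?_) ?_ (summable_evenExt hρ)
  · have h1 : 0 ≤ evenExt ρ m := hnn _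
    have h2 : evenExt ρ m ≤ 1 := hle _
    nlinarith
  · exact (summable_mul_shift (summable_evenExt hρ) 0).congr fun m => by rw [add_zero, sq]

/-- `S₁ = Σ_{t≥1} K(t) = 2τ² − K(0)/2`. -/
theorem tsum_acfConv_succ_eq {ρ : ℕ → ℝ} (hρ : Summable ρ) (h0 : ρ 0 = 1) :
    ∑' t : ℕ, acfConv (evenExt ρ) ((t + 1 : ℕ) : ℤ) = 2 * tauInt ρ ^ 2 - acfConv (evenExt ρ) 0 / 2 := by
  have := acfConv_zero_add_two_mul_tsum hρ h0
  linarith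

/-- **The limit correction is non-positive for `0 ≤ ρ ≤ 1`**: `L ≤ −4 τ τ₁² ≤ 0`
(`τ₁ = τ − ½ ≥ 0` there). -/
theorem ratioLimit_le {ρ : ℕ → ℝ} (hρ : Summable ρ) (h0 : ρ 0 = 1) (hnn : ∀ t, 0 ≤ ρ t)
    (hle : ∀ t, ρ t ≤ 1) : ratioLimit ρ ≤ -4 * tauInt ρ * (tauInt ρ - 1 / 2) ^ 2 := by
  have hK0 := acfConv_zero_le_two_mul_tauInt hρ h0 hnn hle
  have hτ1 : 0 ≤ tauInt ρ - 1 / 2 := by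
    rw [tauInt, add_sub_cancel_left]
    exact tsum_nonneg fun t => hnn _
  rw [ratioLimit, tsum_acfConv_succ_eq hρ h0]
  nlinarith [mul_nonneg hτ1 hτ1, sq_nonneg (tauInt ρ - 1 / 2)]

/-- Hence `L ≤ 0` for `0 ≤ ρ ≤ 1`. -/
theorem ratioLimit_nonpos {ρ : ℕ → ℝ} (hρ : Summable ρ) (h0 : ρ 0 = 1) (hnn : ∀ t, 0 ≤ ρ t)
    (hle : ∀ t, ρ t ≤ 1) : ratioLimit ρ ≤ 0 := by
  have hτ : 0 ≤ tauInt ρ := by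
    rw [tauInt]
    exact add_nonneg (by norm_num) (tsum_nonneg fun t => hnn _)
  refine (ratioLimit_le hρ h0 hnn hle).trans ?_
  nlinarith [sq_nonneg (tauInt ρ - 1 / 2)]

/-- **Eventually `R(W) < (4W+2) τ²`** for `0 ≤ ρ ≤ 1` (`τ_int ≠ 0`): at all large windows the printed
Madras–Sokal bar over-covers the Gaussian-model standard deviation of the (linearised) ratio
estimator too.  (`V(W) ≤ 4Wτ²` at every `W`, and `R − V → L ≤ 0 < 2τ²`.) -/
theorem eventually_tauHatRatioAVar_lt_printed {ρ : ℕ → ℝ} (hρ : Summable ρ) (h0 : ρ 0 = 1)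
    (hnn : ∀ t, 0 ≤ ρ t) (hle : ∀ t, ρ t ≤ 1) (hτ : tauInt ρ ≠ 0) :
    ∀ᶠ W : ℕ in atTop, tauHatRatioAVar ρ W < (4 * W + 2) * tauInt ρ ^ 2 := by
  have hτ2 : 0 < tauInt ρ ^ 2 := by positivity
  have hlt : ratioLimit ρ < 2 * tauInt ρ ^ 2 :=
    (ratioLimit_nonpos hρ h0 hnn hle).trans_lt (by positivity)
  have hev := (tendsto_tauHatRatioAVar_sub hρ).eventually (gt_mem_nhds hlt)
  filter_upwards [hev] with W hW
  have hV := tauHatAVar_le hρ h0 hnn W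
  linarith

end Summit.Ventures.LatticeQCDFlow.Scoring
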